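import Summits.NavierStokesRegularity.NavierStokesRegularity.Theorems.LocalIrrotationalScarDoorAnyWindow
import Summits.NavierStokesRegularity.NavierStokesRegularity.Theorems.QuietScarPocketDoorAnyWindowLocal
import Summits.NavierStokesRegularity.NavierStokesRegularity.Theorems.QuietScarPocketDoorLegF
import Summits.NavierStokesRegularity.NavierStokesRegularity.Theorems.QuietScarPocketDoorFrame

/-!
# QuietScarPocketDoorAnyWindowTrace — plate PX of ROUND-29 §8: the UNCONDITIONAL any-window trace door
# (texts: nsreg-p1 g25 `r29/Sketch31C.lean` sha16 ec23287f089fe884, VERBATIM; proofs: nsreg-C26-p1 g4, DIRECTOR-NS #206 (2))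

Corollary sheet (B-sheet), S15 lane.  With LEG F of door S31 a tree theorem
(`QuietScarPocketDoor.terminalSliceVelocityAnalyticity_holds`, p625220), the STAGED S15 LEVEL-2 theorem
`LocalIrrotationalScarDoorAnyWindow.localIrrotationalScarDoor_anyWindow` drops its analyticity hypothesis
`AnalyticOnNhd ℝ (u T) (ball x₀ ρ \ {x₀})`: it follows from the local one-point Type-I bound (sup `|u| ≤ M/dist` off
the apex), the Leray–Hopf pressure representation (sup of the point-gauged pressure near `T`,
`QuietScarPocketDoorAnyWindowLocal.exists_offApex_pressure_bound`), viscosity normalisation (the Pineau–Vicol frame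
CENTRED OFF THE APEX, `pvFrame_isClassical`), LEG F, and uniqueness of limits against the pointwise trace hypothesis.
The TRACE hypothesis `u t x → u T x` (x ≠ x₀) is KEPT: the door is about trace-extended solutions.

* `OffApexTraceAnalyticAt ν M` / `OffApexTraceAnalytic` — plate PX (texts verbatim) — and **`offApexTraceAnalytic_holds`**
  (PROVED here);
* `TargetAnyWindowTraceAt ν M` / `TargetAnyWindowTrace` — the unconditional any-window door (texts verbatim): class +
  local Type I(M) + pointwise trace off the apex + `curl (u T)` vanishes near ONE point of the punctured ball ⇒ backward
  bounded at `x₀`;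
* `targetAnyWindowTraceAt_of`, `targetAnyWindowTrace_of`, `curl_trace_no_pocket_of_singular` (compositions, verbatim) and
  **`targetAnyWindowTrace_holds : TargetAnyWindowTrace`**.

HONEST FRAME: a corollary door — S15 LEVEL-2 made unconditional, the qualitative twin of S31 (`ε = 0`, arbitrary
pocket); a regularity CRITERION on HYPOTHETICAL one-point Type-I profiles (scar reading: at a local Type-I singular point
the terminal vorticity trace has no irrotational pocket in the punctured Type-I ball).  Item 0056 `NoTypeII` and
Navier–Stokes regularity are NOT proved.
-/

noncomputable section

open MeasureTheory Set Function Filter Topology TopologicalSpace Metric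
open Literature.Analysis Literature.Analysis.FluidPDE
open Summit.NavierStokesRegularity.NavierStokesRegularity.Theorems.LocalIrrotationalScarDoorAnyWindow
open Summit.NavierStokesRegularity.NavierStokesRegularity.Theorems.PeepholeVorticityDoor (pvFrame_isClassical)
open scoped RealInnerProductSpace

set_option linter.dupNamespace false

namespace Summit.NavierStokesRegularity.NavierStokesRegularity.Theorems.QuietScarPocketDoor

/-- **Plate PX (S/M): off-apex analyticity of the terminal trace.**  Class of the S15 any-window
theorem (classical on `[0,T)`, Leray–Hopf from a rapidly decaying datum), local one-point Type I(`M`)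
on `Q_ρ(x₀,T)`, pointwise velocity trace `u T` off the apex ⇒ `u T` is real-analytic on
`B(x₀,ρ) ∖ {x₀}`.  (Proof path: off-apex sup bounds for `u` from the one-point bound and for `p` from
the Leray–Hopf pressure representation on `(T−η,T) × B(x,4r)`, `B(x,4r) ⊂ B(x₀,ρ) ∖ {x₀}`; viscosity
/translation normalisation; `terminalSliceVelocityAnalyticity_holds`; uniqueness of limits.) -/
def OffApexTraceAnalyticAt (ν M : ℝ) : Prop :=
  ∀ (T : ℝ), 0 < T → ∀ (u : ℝ → EuclideanSpace ℝ (Fin 3) → EuclideanSpace ℝ (Fin 3))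
      (p : ℝ → EuclideanSpace ℝ (Fin 3) → ℝ),
    IsClassicalNSSolutionOn (Set.Ico 0 T) ν 0 u p → IsLerayHopfOn T ν 0 (u 0) u →
    HasRapidSpatialDecay (u 0) →
    ∀ (x₀ : EuclideanSpace ℝ (Fin 3)) (ρ : ℝ), 0 < ρ →
    (∀ t ∈ Set.Ico 0 T, T - ρ ^ 2 < t → ∀ x ∈ ball x₀ ρ,
      ‖u t x‖ * (‖x - x₀‖ + Real.sqrt (ν * (T - t))) ≤ M) →
    (∀ x ∈ ball x₀ ρ, x ≠ x₀ → Tendsto (fun t => u t x) (𝓝[<] T) (𝓝 (u T x))) →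
    AnalyticOnNhd ℝ (u T) (ball x₀ ρ \ {x₀})

/-- Plate PX for every viscosity and Type-I constant (the closed form probed by bc7). -/
def OffApexTraceAnalytic : Prop := ∀ (ν M : ℝ), 0 < ν → OffApexTraceAnalyticAt ν M

/-- **The unconditional any-window trace door at `(ν, M)`:** class as above, local Type I(`M`) on
`Q_ρ(x₀,T)`, pointwise trace off the apex, and `curl (u T) = 0` near ONE point of the punctured ball
⇒ backward bounded at `x₀`. -/
def TargetAnyWindowTraceAt (ν M : ℝ) : Prop :=
  ∀ (T : ℝ), 0 < T → ∀ (u : ℝ → EuclideanSpace ℝ (Fin 3) → EuclideanSpace ℝ (Fin 3))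
      (p : ℝ → EuclideanSpace ℝ (Fin 3) → ℝ),
    IsClassicalNSSolutionOn (Set.Ico 0 T) ν 0 u p → IsLerayHopfOn T ν 0 (u 0) u →
    HasRapidSpatialDecay (u 0) →
    ∀ (x₀ : EuclideanSpace ℝ (Fin 3)) (ρ : ℝ), 0 < ρ →
    (∀ t ∈ Set.Ico 0 T, T - ρ ^ 2 < t → ∀ x ∈ ball x₀ ρ,
      ‖u t x‖ * (‖x - x₀‖ + Real.sqrt (ν * (T - t))) ≤ M) →
    (∀ x ∈ ball x₀ ρ, x ≠ x₀ → Tendsto (fun t => u t x) (𝓝[<] T) (𝓝 (u T x))) →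
    (∃ z ∈ ball x₀ ρ, z ≠ x₀ ∧ curl (u T) =ᶠ[𝓝 z] 0) →
    IsBackwardBoundedAt u T x₀

/-- **The unconditional any-window trace door:** every viscosity, every Type-I constant. -/
def TargetAnyWindowTrace : Prop :=
  ∀ (ν : ℝ), 0 < ν → ∀ (M : ℝ), TargetAnyWindowTraceAt ν M

/-- COMPOSITION (proved): plate PX closes the unconditional any-window door through the tree's
staged S15 LEVEL-2 theorem `localIrrotationalScarDoor_anyWindow`. -/
theorem targetAnyWindowTraceAt_of {ν M : ℝ} (hν : 0 < ν) (hPX : OffApexTraceAnalyticAt ν M) :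
    TargetAnyWindowTraceAt ν M := by
  intro T hT u p hcl hLH hdec x₀ ρ hρ hI htr hz
  exact localIrrotationalScarDoor_anyWindow ν T hν hT u p hcl hLH hdec x₀ ρ M hρ hI htr
    (hPX T hT u p hcl hLH hdec x₀ ρ hρ hI htr) hz

/-- COMPOSITION (proved), every viscosity and Type-I constant. -/
theorem targetAnyWindowTrace_of (hPX : OffApexTraceAnalytic) : TargetAnyWindowTrace :=
  fun ν hν M => targetAnyWindowTraceAt_of hν (hPX ν M hν)

/-- Scar reading of the door (contrapositive, proved): at a local Type-I point which IS backward
singular, the terminal trace's curl vanishes near NO point of the punctured Type-I ball. -/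
theorem curl_trace_no_pocket_of_singular {ν M : ℝ} (hν : 0 < ν) (hPX : OffApexTraceAnalyticAt ν M)
    {T : ℝ} (hT : 0 < T) {u : ℝ → EuclideanSpace ℝ (Fin 3) → EuclideanSpace ℝ (Fin 3)}
    {p : ℝ → EuclideanSpace ℝ (Fin 3) → ℝ}
    (hcl : IsClassicalNSSolutionOn (Set.Ico 0 T) ν 0 u p) (hLH : IsLerayHopfOn T ν 0 (u 0) u)
    (hdec : HasRapidSpatialDecay (u 0)) {x₀ : EuclideanSpace ℝ (Fin 3)} {ρ : ℝ} (hρ : 0 < ρ)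
    (hI : ∀ t ∈ Set.Ico 0 T, T - ρ ^ 2 < t → ∀ x ∈ ball x₀ ρ,
      ‖u t x‖ * (‖x - x₀‖ + Real.sqrt (ν * (T - t))) ≤ M)
    (htr : ∀ x ∈ ball x₀ ρ, x ≠ x₀ → Tendsto (fun t => u t x) (𝓝[<] T) (𝓝 (u T x)))
    (hsing : ¬ IsBackwardBoundedAt u T x₀) :
    ∀ z ∈ ball x₀ ρ, z ≠ x₀ → ¬ (curl (u T) =ᶠ[𝓝 z] 0) :=
  fun z hz hzx hcz => hsing (targetAnyWindowTraceAt_of hν hPX T hT u p hcl hLH hdec x₀ ρ hρ hI htr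
    ⟨z, hz, hzx, hcz⟩)

/-! ### The proof of plate PX -/

/-- **Plate PX holds: `OffApexTraceAnalytic`.**  At `y ≠ x₀` in the Type-I ball take the off-apex data of
`exists_offApex_pressure_bound` (scale `λ`, `λ² = νβ`, `B(y,λ) ⊆ B(x₀,ρ) ∖ {x₀}`, `‖u‖ ≤ A₀` and `|p − p(·,y)| ≤ P₀` on
`(T−β,T) × B(y,λ)`); the Pineau–Vicol frame centred at `y` is then a BOUNDED classical pair with BOUNDED gauged pressure on
`(−1,0) × B₁`, so LEG F (`terminalSliceVelocityAnalyticity_holds`, `r = 1/4`) gives a real-analytic `v₀` on `B(0,1/4)` with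
`v(s,z) → v₀(z)` as `s ↑ 0`; by the trace hypothesis and `t = T + βs ↑ T`, `v₀(z) = (λ/ν) u(T, y + λz)` (uniqueness of
limits), whence `u(T,·) = (ν/λ) v₀(λ⁻¹(· − y))` near `y` is analytic at `y`. [cite: PineauVicol2026, Prop. 9.5 proof;
Tao2011, Lemma 4.1 (i)] -/
theorem offApexTraceAnalytic_holds : OffApexTraceAnalytic := by
  intro ν M hν T hT u p hcl hLH _hdec x₀ ρ hρ hM htr y hy
  obtain ⟨hyρ, hy0⟩ := hy
  have hy0' : y ≠ x₀ := fun h => hy0 (by rw [h]; exact mem_singleton _)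
  obtain ⟨lam, A₀, P₀, hlam, hβT, hA₀, hP₀, hball, hvel, hpres⟩ :=
    exists_offApex_pressure_bound hν hT hcl hLH hρ hM hyρ hy0'
  set β : ℝ := lam ^ 2 / ν with hβ_def
  have hβ0 : 0 < β := by positivity
  have hlam_eq : Real.sqrt (ν * β) = lam := by
    rw [hβ_def, show ν * (lam ^ 2 / ν) = lam ^ 2 by field_simp, Real.sqrt_sq hlam.le]
  -- the Pineau–Vicol frame centred at `y`, point gauge `y`
  set v : ℝ → EuclideanSpace ℝ (Fin 3) → EuclideanSpace ℝ (Fin 3) := (lam / ν) • stPull β lam T y u with hv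
  set q : ℝ → EuclideanSpace ℝ (Fin 3) → ℝ := (lam / ν) ^ 2 • stPull β lam T y (fun t x => p t x - p t y) with hq
  have hreg : IsClassicalNSSolutionOnRegion (Ico (-1 : ℝ) 0 ×ˢ ball (0 : EuclideanSpace ℝ (Fin 3)) 1) 1 0 v q := by
    have := pvFrame_isClassical hν hcl hβ0 hβT y y
    rwa [hlam_eq] at this
  have hreg' : IsClassicalNSSolutionOnRegion
      (Ioo (-1 : ℝ) 0 ×ˢ ball (0 : EuclideanSpace ℝ (Fin 3)) (4 * (1 / 4))) 1 0 v q :=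
    hreg.mono_of_isOpen (prod_mono Ioo_subset_Ico_self (ball_subset_ball (by norm_num)))
      (isOpen_Ioo.prod isOpen_ball)
  -- physical points of the unit cylinder
  have hphys : ∀ s ∈ Ioo (-1 : ℝ) 0, ∀ z ∈ ball (0 : EuclideanSpace ℝ (Fin 3)) (4 * (1 / 4)),
      T + β * s ∈ Ioo (T - lam ^ 2 / ν) T ∧ y + lam • z ∈ ball y lam := by
    intro s hs z hz
    refine ⟨⟨by rw [← hβ_def]; nlinarith [hs.1], by nlinarith [hs.2]⟩, ?_⟩
    rw [mem_ball, dist_eq_norm, add_sub_cancel_left, norm_smul, Real.norm_of_nonneg hlam.le]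
    rw [mem_ball, dist_zero_right] at hz
    nlinarith
  have hvb : ∀ s ∈ Ioo (-1 : ℝ) 0, ∀ z ∈ ball (0 : EuclideanSpace ℝ (Fin 3)) (4 * (1 / 4)),
      ‖v s z‖ ≤ lam / ν * A₀ := by
    intro s hs z hz
    obtain ⟨ht, hx⟩ := hphys s hs z hz
    rw [hv, smul_stPull_apply, norm_smul, Real.norm_of_nonneg (by positivity : (0 : ℝ) ≤ lam / ν)]
    exact mul_le_mul_of_nonneg_left (hvel _ ⟨ht.1.le, ht.2⟩ _ hx) (by positivity)
  have hqb : ∀ s ∈ Ioo (-1 : ℝ) 0, ∀ z ∈ ball (0 : EuclideanSpace ℝ (Fin 3)) (4 * (1 / 4)),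
      |q s z| ≤ (lam / ν) ^ 2 * P₀ := by
    intro s hs z hz
    obtain ⟨ht, hx⟩ := hphys s hs z hz
    rw [hq, smul_stPull_apply, smul_eq_mul, abs_mul, abs_of_nonneg (sq_nonneg _)]
    exact mul_le_mul_of_nonneg_left (hpres _ ht _ hx) (sq_nonneg _)
  -- LEG F on the frame
  obtain ⟨v₀, hA, hconv, -⟩ := terminalSliceVelocityAnalyticity_holds 0 (1 / 4) (-1) (lam / ν * A₀)
    ((lam / ν) ^ 2 * P₀) (by norm_num) (by norm_num) (by positivity) (by positivity) v q hreg' hvb hqb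
  -- identification of the analytic limit with the rescaled trace
  have hid : ∀ z ∈ ball (0 : EuclideanSpace ℝ (Fin 3)) (1 / 4), v₀ z = (lam / ν) • u T (y + lam • z) := by
    intro z hz
    have hz' : z ∈ ball (0 : EuclideanSpace ℝ (Fin 3)) (4 * (1 / 4)) := ball_subset_ball (by norm_num) hz
    have hx : y + lam • z ∈ ball y lam := by
      rw [mem_ball, dist_eq_norm, add_sub_cancel_left, norm_smul, Real.norm_of_nonneg hlam.le]
      rw [mem_ball, dist_zero_right] at hz'
      nlinarith
    obtain ⟨hxρ, hx0⟩ := hball _ hx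
    have h1 := hconv z hz
    have h2 : Tendsto (fun s => v s z) (𝓝[<] (0 : ℝ)) (𝓝 ((lam / ν) • u T (y + lam • z))) := by
      have ht := ((htr _ hxρ hx0).comp (tendsto_time_affine_nhdsLT (T := T) hβ0)).const_smul (lam / ν)
      refine ht.congr fun s => ?_
      simp only [hv, Function.comp_apply, smul_stPull_apply]
    exact tendsto_nhds_unique h1 h2
  -- analyticity at `y`
  have hlin : AnalyticAt ℝ (fun x : EuclideanSpace ℝ (Fin 3) => lam⁻¹ • (x - y)) y :=
    (analyticAt_id.fun_sub analyticAt_const).fun_const_smul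
  have h0 : lam⁻¹ • (y - y) = (0 : EuclideanSpace ℝ (Fin 3)) := by simp
  have hv₀y : AnalyticAt ℝ v₀ (lam⁻¹ • (y - y)) := by
    rw [h0]; exact hA 0 (mem_ball_self (by norm_num))
  have hcomp0 : AnalyticAt ℝ (v₀ ∘ fun x : EuclideanSpace ℝ (Fin 3) => lam⁻¹ • (x - y)) y :=
    AnalyticAt.comp (f := fun x : EuclideanSpace ℝ (Fin 3) => lam⁻¹ • (x - y)) hv₀y hlin
  have hcomp : AnalyticAt ℝ (fun x : EuclideanSpace ℝ (Fin 3) => (ν / lam) • v₀ (lam⁻¹ • (x - y))) y := by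
    exact (analyticAt_const (v := ν / lam)).smul hcomp0
  refine hcomp.congr ?_
  filter_upwards [ball_mem_nhds y (by positivity : (0 : ℝ) < lam / 4)] with x hx
  have hz : lam⁻¹ • (x - y) ∈ ball (0 : EuclideanSpace ℝ (Fin 3)) (1 / 4) := by
    rw [mem_ball, dist_zero_right, norm_smul, norm_inv, Real.norm_of_nonneg hlam.le, inv_mul_lt_iff₀ hlam]
    rw [mem_ball, dist_eq_norm] at hx
    linarith
  rw [hid _ hz, smul_smul, smul_inv_smul₀ hlam.ne', add_sub_cancel,
    show ν / lam * (lam / ν) = 1 by field_simp, one_smul]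

/-- **The unconditional any-window trace door HOLDS** (`TargetAnyWindowTrace`): plate PX + the staged S15 LEVEL-2
theorem.  Criterion on hypothetical one-point Type-I profiles; 0056 / NS regularity NOT proved. -/
theorem targetAnyWindowTrace_holds : TargetAnyWindowTrace :=
  targetAnyWindowTrace_of offApexTraceAnalytic_holds

end Summit.NavierStokesRegularity.NavierStokesRegularity.Theorems.QuietScarPocketDoor

end
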